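import Literature.IUT.HodgeTheaters.InitialThetaDataRemarks
import Literature.IUT.HodgeTheaters.ThetaGeometryInhabited
import Mathlib.Topology.Instances.ZMod
import Mathlib.FieldTheory.Galois.Infinite
import Mathlib.Topology.Algebra.Category.ProfiniteGrp.Basic
import HarnessLib

/-!
# [IUTchI] Remark 3.1.2 (i) as typed (`InitialThetaData.PiXKCharacteristic`): kernel closure census
# of the FACT-LIST row F-0266 (DAG id `N_IUTchI_Rmk3_1_2_i`)

S. Mochizuki, *Inter-universal Teichmüller theory I*, RIMS manuscript (May 2020; = PRIMS **57** (2021)),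
§3, Remark 3.1.2 (i), kurims p. 64: "the open subgroup `Π_{X_K} ⊆ Π_{C_K}` may be constructed
group-theoretically from the topological group `Π_{C_K}`" (via the cuspidal decomposition groups,
[AbsTopI] Lemma 4.5) [cite: Mochizuki2012, IUTchI Rmk 3.1.2 (i) p.64].  The tree types this
(abc-iut-L5-t2, `InitialThetaDataRemarks.lean`) as the predicate
`D.PiXKCharacteristic : Prop` on an initial Θ-datum `D : InitialThetaData F K F̄ E l P`:
*every bicontinuous group automorphism of `Π_{C_K}` carries `Π_{X_K}` onto itself*.

PROOF-ONLY companion (theorems only, no definition, nothing of the paper retyped; abc-iut cell, wave-4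
seat abc-iut-w4-d075 on the unseated tranche 191 of `plan/F-TRANCHES.tsv`, director C3 default).  What
this file makes kernel-visible about the ROW (not about the paper):

* In `InitialThetaData` the arithmetic clauses (a)–(c) of Def. 3.1 are REAL, but the `π₁`-clauses
  (b)(d)(f) enter through the INTERFACE field `geom : ThetaGeometry G_F G_K l`, which records only the
  printed index / openness / surjectivity conditions (abc-iut-S2's `ThetaGeometryInhabited.lean` builds
  the profinite model `G × (ℤ/2 × ℤ/l)` of it).  `PiXKCharacteristic` reads `geom` alone.
* Here a second profinite model of the same interface is built INSIDE a proof (no definition is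
  added to the tree): `Π_{C_F} := G_F × (ℤ/2 × ℤ/2 × ℤ/l)`, `Π_{X_F} := G_F × ({0} × ℤ/2 × ℤ/l)`,
  `Π_{C_K} := G_K × (ℤ/2 × ℤ/2 × ℤ/l)` embedded by the inclusion, `Π_{C̲_K} := G_K × (ℤ/2 × ℤ/2 × {0})`
  (so `[Π_{C_K} : Π_{X_K}] = 2`, `[Π_{X_K} : Π_{X̲_K}] = l`, `[Π_{C̲_K} : Π_{X̲_K}] = 2`,
  `Π_{C̲_K} ⊄ Π_{X_K}`, condition (∗) trivially), for which the SWAP of the two `ℤ/2`-coordinates is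
  a bicontinuous automorphism of `Π_{C_K}` that does NOT preserve `Π_{X_K}`
  (`exists_thetaGeometry_piXK_not_invariant`).
* Consequently, re-gluing the `geom` field of ANY initial Θ-datum `D` along this model gives a datum
  `D'` over the SAME carriers, curve, prime, bad places and `V̲` with `¬ D'.PiXKCharacteristic`
  (`exists_not_piXKCharacteristic`); so the universal closure of the row fails at every inhabited
  parameter tuple (`not_forall_piXKCharacteristic`).  R5 class: the row is a SCHEMA in the free
  `geom` slot — consumable AT A NAMED étale inhabitant only, where its content is exactly [AbsTopI]
  Lemma 4.5 (cuspidal decomposition groups are group-theoretic), which the interface does not carry.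
Elementary profinite-group bookkeeping; a finding about the TYPING (a free interface parameter), not
about [IUTchI]; nothing here bears on [IUTchIII] Cor. 3.12 or takes a side; typed ≠ proved; a FACT row
is an assumption label, not an endorsement. -/

noncomputable section

namespace Literature.IUT.HodgeTheaters.InitialThetaData

open Literature.AnabelianGeometry.AbsoluteAnabelian Topology

universe u v w

/-! ## The finite factor `ℤ/2 × ℤ/2 × ℤ/l` (multiplicative notation) and its subgroups -/

section Finite

variable (l : ℕ)

/-- `[ℤ/2 × ℤ/2 × ℤ/l : {0} × ℤ/2 × ℤ/l] = 2`. [folklore] -/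
private theorem index_X3 :
    ((⊥ : Subgroup (Multiplicative (ZMod 2))).prod
      (⊤ : Subgroup (Multiplicative (ZMod 2) × Multiplicative (ZMod l)))).index = 2 := by
  rw [Subgroup.index_prod, Subgroup.index_bot, Subgroup.index_top, mul_one,
    Nat.card_congr Multiplicative.toAdd, Nat.card_zmod]

/-- `[ℤ/2 × ℤ/2 × ℤ/l : ℤ/2 × ℤ/2 × {0}] = l`. [folklore] -/
private theorem index_C3 :
    ((⊤ : Subgroup (Multiplicative (ZMod 2))).prod
      ((⊤ : Subgroup (Multiplicative (ZMod 2))).prod (⊥ : Subgroup (Multiplicative (ZMod l))))).index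
      = l := by
  rw [Subgroup.index_prod, Subgroup.index_prod, Subgroup.index_bot, Subgroup.index_top, one_mul,
    one_mul, Nat.card_congr Multiplicative.toAdd, Nat.card_zmod]

/-- `[ℤ/2 × ℤ/2 × ℤ/l : {0} × ℤ/2 × {0}] = 2 l`. [folklore] -/
private theorem index_Xbar3 :
    ((⊥ : Subgroup (Multiplicative (ZMod 2))).prod
      ((⊤ : Subgroup (Multiplicative (ZMod 2))).prod (⊥ : Subgroup (Multiplicative (ZMod l))))).index
      = 2 * l := by
  rw [Subgroup.index_prod, Subgroup.index_prod, Subgroup.index_bot, Subgroup.index_bot,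
    Subgroup.index_top, one_mul, Nat.card_congr Multiplicative.toAdd, Nat.card_zmod,
    Nat.card_congr Multiplicative.toAdd, Nat.card_zmod]

/-- `({0} × ℤ/2 × ℤ/l) ∩ (ℤ/2 × ℤ/2 × {0}) = {0} × ℤ/2 × {0}`. [folklore] -/
private theorem X3_inf_C3 :
    (⊥ : Subgroup (Multiplicative (ZMod 2))).prod
        (⊤ : Subgroup (Multiplicative (ZMod 2) × Multiplicative (ZMod l))) ⊓
      (⊤ : Subgroup (Multiplicative (ZMod 2))).prod
        ((⊤ : Subgroup (Multiplicative (ZMod 2))).prod (⊥ : Subgroup (Multiplicative (ZMod l)))) =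
    (⊥ : Subgroup (Multiplicative (ZMod 2))).prod
      ((⊤ : Subgroup (Multiplicative (ZMod 2))).prod (⊥ : Subgroup (Multiplicative (ZMod l)))) := by
  ext ⟨a, b, c⟩
  simp only [Subgroup.mem_inf, Subgroup.mem_prod, Subgroup.mem_top, Subgroup.mem_bot, true_and,
    and_true]

/-- `[{0} × ℤ/2 × ℤ/l : {0} × ℤ/2 × {0}] = l`. [folklore] -/
private theorem relIndex_Xbar3_X3 :
    ((⊥ : Subgroup (Multiplicative (ZMod 2))).prod
      ((⊤ : Subgroup (Multiplicative (ZMod 2))).prod (⊥ : Subgroup (Multiplicative (ZMod l))))).relIndex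
      ((⊥ : Subgroup (Multiplicative (ZMod 2))).prod
        (⊤ : Subgroup (Multiplicative (ZMod 2) × Multiplicative (ZMod l)))) = l := by
  have hle : (⊥ : Subgroup (Multiplicative (ZMod 2))).prod
      ((⊤ : Subgroup (Multiplicative (ZMod 2))).prod (⊥ : Subgroup (Multiplicative (ZMod l)))) ≤
      (⊥ : Subgroup (Multiplicative (ZMod 2))).prod
        (⊤ : Subgroup (Multiplicative (ZMod 2) × Multiplicative (ZMod l))) :=
    Subgroup.prod_mono le_rfl le_top
  have h := Subgroup.relIndex_mul_index hle
  rw [index_X3, index_Xbar3, mul_comm 2 l] at h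
  exact Nat.eq_of_mul_eq_mul_right two_pos h

/-- `[ℤ/2 × ℤ/2 × {0} : {0} × ℤ/2 × {0}] = 2`. [folklore] -/
private theorem relIndex_Xbar3_C3 [NeZero l] :
    ((⊥ : Subgroup (Multiplicative (ZMod 2))).prod
      ((⊤ : Subgroup (Multiplicative (ZMod 2))).prod (⊥ : Subgroup (Multiplicative (ZMod l))))).relIndex
      ((⊤ : Subgroup (Multiplicative (ZMod 2))).prod
        ((⊤ : Subgroup (Multiplicative (ZMod 2))).prod (⊥ : Subgroup (Multiplicative (ZMod l))))) = 2 := by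
  have hle : (⊥ : Subgroup (Multiplicative (ZMod 2))).prod
      ((⊤ : Subgroup (Multiplicative (ZMod 2))).prod (⊥ : Subgroup (Multiplicative (ZMod l)))) ≤
      (⊤ : Subgroup (Multiplicative (ZMod 2))).prod
        ((⊤ : Subgroup (Multiplicative (ZMod 2))).prod (⊥ : Subgroup (Multiplicative (ZMod l)))) :=
    Subgroup.prod_mono le_top le_rfl
  have h := Subgroup.relIndex_mul_index hle
  rw [index_C3, index_Xbar3] at h
  exact Nat.eq_of_mul_eq_mul_right (Nat.pos_of_ne_zero (NeZero.ne l)) h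

end Finite

/-! ## The twisted profinite model of the `π₁`-interface and its coordinate swap -/

section Model

variable {GF : Type w} [Group GF] [TopologicalSpace GF] [IsTopologicalGroup GF] [CompactSpace GF]
  [TotallyDisconnectedSpace GF] (GK : Subgroup GF) (l : ℕ) [NeZero l]

omit [NeZero l] in
/-- In `G × (ℤ/2 × ℤ/2 × ℤ/l)` the commutator of any `g` with an element `x` of the geometric part
`{1} × (ℤ/2 × ℤ/2 × ℤ/l)` is trivial (the finite factor is abelian) — condition (∗) of [IUTchI] §1 in
the model. [cite: Mochizuki2012, IUTchI §1 p.37] -/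
private theorem comm_eq_one_of_fst_eq_one {G : Type w} [Group G]
    (g x : G × (Multiplicative (ZMod 2) × (Multiplicative (ZMod 2) × Multiplicative (ZMod l))))
    (hx : x.1 = 1) : g * x * g⁻¹ * x⁻¹ = 1 := by
  obtain ⟨σ, d'⟩ := g
  obtain ⟨τ, d⟩ := x
  simp only at hx
  subst hx
  refine Prod.ext ?_ ?_
  · simp
  · show d' * d * d'⁻¹ * d⁻¹ = 1
    rw [mul_comm d' d, mul_inv_cancel_right, mul_inv_cancel]

/-- **The twisted model and its swap.**  For a compact totally disconnected `G_F`, a closed subgroup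
`G_K` and `l ≥ 5` prime to `6` there is an inhabitant `G` of the `π₁`-interface
`ThetaGeometry G_F G_K l` of [IUTchI] Def. 3.1 (b)(d)(f) — `Π_{C_F} := G_F × (ℤ/2 × ℤ/2 × ℤ/l)`,
`Π_{X_F} := G_F × ({0} × ℤ/2 × ℤ/l)`, `Π_{C_K} := G_K × (ℤ/2 × ℤ/2 × ℤ/l)`,
`Π_{C̲_K} := G_K × (ℤ/2 × ℤ/2 × {0})` — together with a bicontinuous automorphism `φ` of
`Π_{C_K} = G.embK.range` (the swap of the two `ℤ/2`-coordinates) that does not carry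
`Π_{X_K} = Π_{X_F} ∩ Π_{C_K}` into itself. [cite: Mochizuki2012, IUTchI Rmk 3.1.2 (i) p.64] -/
theorem exists_thetaGeometry_piXK_not_invariant (hGK : IsClosed (GK : Set GF)) (h5 : 5 ≤ l)
    (h6 : l.Coprime 6) :
    ∃ (G : ThetaGeometry GF GK l) (φ : G.embK.range ≃* G.embK.range),
      Continuous φ ∧ Continuous φ.symm ∧
        ((G.PiX ⊓ G.embK.range).subgroupOf G.embK.range).map φ.toMonoidHom ≠
          (G.PiX ⊓ G.embK.range).subgroupOf G.embK.range := by
  letI : CompactSpace GK := isCompact_iff_compactSpace.mp hGK.isCompact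
  -- the finite factor and its three subgroups
  let A : Type := Multiplicative (ZMod 2) × (Multiplicative (ZMod 2) × Multiplicative (ZMod l))
  let X3 : Subgroup A := (⊥ : Subgroup (Multiplicative (ZMod 2))).prod ⊤
  let C3 : Subgroup A :=
    (⊤ : Subgroup (Multiplicative (ZMod 2))).prod ((⊤ : Subgroup (Multiplicative (ZMod 2))).prod ⊥)
  let Xbar3 : Subgroup A :=
    (⊥ : Subgroup (Multiplicative (ZMod 2))).prod ((⊤ : Subgroup (Multiplicative (ZMod 2))).prod ⊥)
  -- pulled back to `G × A` along the second projection
  let lift : ∀ (G : Type w) [Group G], Subgroup A → Subgroup (G × A) :=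
    fun G _ D => D.comap (MonoidHom.snd G A)
  have lift_index : ∀ (G : Type w) [Group G] (D : Subgroup A), (lift G D).index = D.index :=
    fun G _ D => Subgroup.index_comap_of_surjective D Prod.snd_surjective
  have lift_relIndex : ∀ (G : Type w) [Group G] (D D' : Subgroup A),
      (lift G D).relIndex (lift G D') = D.relIndex D' := by
    intro G _ D D'
    show (D.comap (MonoidHom.snd G A)).relIndex (D'.comap (MonoidHom.snd G A)) = D.relIndex D'
    rw [Subgroup.relIndex_comap, Subgroup.map_comap_eq_self_of_surjective Prod.snd_surjective]
  have lift_inf : ∀ (G : Type w) [Group G] (D D' : Subgroup A),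
      lift G (D ⊓ D') = lift G D ⊓ lift G D' := fun G _ D D' => Subgroup.comap_inf D D' _
  have lift_surj : ∀ (G : Type w) [Group G] (D : Subgroup A),
      Function.Surjective ((MonoidHom.fst G A).comp (lift G D).subtype) := by
    intro G _ D g
    exact ⟨⟨(g, 1), show (1 : A) ∈ D from D.one_mem⟩, rfl⟩
  have lift_isOpen : ∀ (G : Type w) [Group G] [TopologicalSpace G] (D : Subgroup A),
      IsOpen (lift G D : Set (G × A)) :=
    fun G _ _ D => (isOpen_discrete (D : Set A)).preimage continuous_snd
  -- the model arithmetic fundamental extensions `G_F × A ↠ G_F`, `G_K × A ↠ G_K`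
  let extF : FundamentalExtension.{w} :=
    { arith := ProfiniteGrp.of (GF × A)
      gal := ProfiniteGrp.of GF
      aug := ContinuousMonoidHom.fst GF A
      aug_surjective := Prod.fst_surjective }
  let extK : FundamentalExtension.{w} :=
    { arith := ProfiniteGrp.of (GK × A)
      gal := ProfiniteGrp.of GK
      aug := ContinuousMonoidHom.fst GK A
      aug_surjective := Prod.fst_surjective }
  -- the `K`-level data ([IUTchI] §1 Def. 1.1 interface) over `G_K`
  have hXbar : lift GK X3 ⊓ lift GK C3 = lift GK Xbar3 := by
    rw [← lift_inf]
    exact congrArg (lift GK) (X3_inf_C3 l)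
  let pe : PuncturedEllipticData.{w} :=
    { l := l
      five_le := h5
      coprime_six := h6
      E := extK
      PiX := lift GK X3
      PiCbar := lift GK C3
      isOpen_piX := lift_isOpen GK X3
      isOpen_piCbar := lift_isOpen GK C3
      index_piX := (lift_index GK X3).trans (index_X3 l)
      aug_piX := lift_surj GK X3
      aug_piCbar := lift_surj GK C3
      star := by
        intro g _ x hx
        have h1 : x.1 = 1 := (FundamentalExtension.mem_geom _).mp hx.2
        have h0 : g * x * g⁻¹ * x⁻¹ = 1 := comm_eq_one_of_fst_eq_one l g x h1
        rw [h0]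
        exact Subgroup.one_mem _
      Cusp := ULift.{w} (Fin 4)
      decomp := fun _ => lift GK ⊥
      decomp_le := fun _ => le_inf (Subgroup.comap_mono bot_le) (Subgroup.comap_mono bot_le)
      ε0 := ⟨0⟩
      ε1 := ⟨1⟩
      ε2 := ⟨2⟩
      twoε := ⟨3⟩
      ε1_ne_ε0 := by decide
      ε2_ne_ε0 := by decide
      ε1_ne_ε2 := by decide
      twoε_ne := by decide
      aug_decomp_twoε := lift_surj GK ⊥ }
  have pe_PiXbar : pe.PiXbar = lift GK Xbar3 := hXbar
  -- the embedding `Π_{C_K} = G_K × A ↪ G_F × A = Π_{C_F}`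
  let embK : (GK × A) →* (GF × A) := MonoidHom.prodMap GK.subtype (MonoidHom.id A)
  have mem_range : ∀ x : GF × A, x ∈ embK.range ↔ x.1 ∈ GK := by
    intro x
    constructor
    · rintro ⟨y, rfl⟩
      exact y.1.property
    · intro hx
      exact ⟨(⟨x.1, hx⟩, x.2), Prod.ext rfl rfl⟩
  let G : ThetaGeometry GF GK l :=
    { extF := extF
      galIso := MulEquiv.refl GF
      galIso_continuous := ⟨continuous_id, continuous_id⟩
      PiX := lift GF X3
      PiX_isOpen := lift_isOpen GF X3
      PiX_normal := Subgroup.normal_comap _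
      PiX_index := (lift_index GF X3).trans (index_X3 l)
      aug_PiX := by
        rw [eq_top_iff]
        intro g _
        exact ⟨(g, 1), show (1 : A) ∈ X3 from X3.one_mem, rfl⟩
      pe := pe
      pe_l := rfl
      embK := embK
      embK_continuous := continuous_subtype_val.prodMap continuous_id
      embK_injective := by
        rintro ⟨a, b⟩ ⟨c, d⟩ h
        have h1 := congrArg Prod.fst h
        have h2 := congrArg Prod.snd h
        exact Prod.ext (Subtype.ext h1) h2
      embK_range := by
        ext x
        rw [mem_range]
        rfl
      galKIso := MulEquiv.refl GK
      aug_compat := fun _ => rfl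
      embK_PiX := by
        ext x
        constructor
        · rintro ⟨y, hmem, rfl⟩
          exact ⟨hmem, y, rfl⟩
        · rintro ⟨hmem, y, hy⟩
          have h2 : y.2 = x.2 := congrArg Prod.snd hy
          have hmem' : x.2 ∈ X3 := hmem
          refine ⟨y, ?_, hy⟩
          show y.2 ∈ X3
          rw [h2]
          exact hmem'
      PiXbar_relIndex := by
        rw [pe_PiXbar]
        show (lift GK Xbar3).relIndex (lift GK X3) = l
        rw [lift_relIndex, relIndex_Xbar3_X3]
      aug_PiXbar := by
        rw [pe_PiXbar]
        exact lift_surj GK Xbar3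
      PiXbar_relIndex_PiCbar := by
        rw [pe_PiXbar]
        show (lift GK Xbar3).relIndex (lift GK C3) = 2
        rw [lift_relIndex, relIndex_Xbar3_C3]
      not_PiCbar_le_PiX := by
        intro h
        have hmem : ((1 : GK), (Multiplicative.ofAdd (1 : ZMod 2), ((1 : Multiplicative (ZMod 2)),
            (1 : Multiplicative (ZMod l))))) ∈ lift GK C3 :=
          Subgroup.mem_prod.mpr ⟨Subgroup.mem_top _,
            Subgroup.mem_prod.mpr ⟨Subgroup.mem_top _, Subgroup.mem_bot.mpr rfl⟩⟩
        have h2 := (Subgroup.mem_prod.mp (h hmem)).1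
        rw [Subgroup.mem_bot] at h2
        exact absurd (Multiplicative.ofAdd.injective h2) (by decide) }
  -- the swap of the two `ℤ/2`-coordinates on `G_F × A`, restricted to `Π_{C_K} = embK.range`
  let sw : GF × A → GF × A := fun x => (x.1, (x.2.2.1, (x.2.1, x.2.2.2)))
  have sw_sw : ∀ x, sw (sw x) = x := fun _ => rfl
  have sw_mul : ∀ x y, sw (x * y) = sw x * sw y := fun _ _ => rfl
  have sw_cont : Continuous sw := continuous_fst.prodMk ((continuous_fst.comp (continuous_snd.comp
    continuous_snd)).prodMk ((continuous_fst.comp continuous_snd).prodMk (continuous_snd.comp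
    (continuous_snd.comp continuous_snd))))
  have sw_mem : ∀ x : GF × A, x ∈ embK.range → sw x ∈ embK.range := by
    intro x hx
    rw [mem_range] at hx ⊢
    exact hx
  let φ : G.embK.range ≃* G.embK.range :=
    { toFun := fun x => ⟨sw x.1, sw_mem x.1 x.2⟩
      invFun := fun x => ⟨sw x.1, sw_mem x.1 x.2⟩
      left_inv := fun x => Subtype.ext (sw_sw x.1)
      right_inv := fun x => Subtype.ext (sw_sw x.1)
      map_mul' := fun x y => Subtype.ext (sw_mul x.1 y.1) }
  have hφ : Continuous φ := (sw_cont.comp continuous_subtype_val).subtype_mk _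
  have hφs : Continuous φ.symm := (sw_cont.comp continuous_subtype_val).subtype_mk _
  refine ⟨G, φ, hφ, hφs, ?_⟩
  -- the witness `(1, (0, 1, 0)) ∈ Π_{X_K}` is swapped to `(1, (1, 0, 0)) ∉ Π_{X_F}`
  let x₀ : GF × A := ((1 : GF), ((1 : Multiplicative (ZMod 2)), (Multiplicative.ofAdd (1 : ZMod 2),
    (1 : Multiplicative (ZMod l)))))
  have hx₀K : x₀ ∈ G.embK.range := (mem_range x₀).mpr GK.one_mem
  have hx₀X : x₀ ∈ G.PiX :=
    Subgroup.mem_prod.mpr ⟨Subgroup.mem_bot.mpr rfl, Subgroup.mem_top _⟩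
  intro hmap
  have hmem : φ ⟨x₀, hx₀K⟩ ∈ ((G.PiX ⊓ G.embK.range).subgroupOf G.embK.range).map φ.toMonoidHom :=
    ⟨⟨x₀, hx₀K⟩, Subgroup.mem_subgroupOf.mpr ⟨hx₀X, hx₀K⟩, rfl⟩
  rw [hmap, Subgroup.mem_subgroupOf] at hmem
  have hsw : (sw x₀).2 ∈ X3 := hmem.1
  have h1 : Multiplicative.ofAdd (1 : ZMod 2) ∈ (⊥ : Subgroup (Multiplicative (ZMod 2))) :=
    (Subgroup.mem_prod.mp hsw).1
  rw [Subgroup.mem_bot] at h1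
  exact absurd (Multiplicative.ofAdd.injective h1) (by decide)

end Model

/-! ## The row: re-gluing the free `π₁`-interface of an initial Θ-datum -/

section Row

variable {F : Type u} {K : Type v} {Fbar : Type w} [Field F] [NumberField F] [Field K]
  [NumberField K] [Algebra F K] [Field Fbar] [Algebra F Fbar] [Algebra K Fbar]
  {E : WeierstrassCurve F} [E.IsElliptic] {l : ℕ} {P : BadPlacePredicates K}

/-- **F-0266, pointwise form.**  For every initial Θ-datum `D` there is an initial Θ-datum `D'` over the
SAME carriers `F ⊆ K ⊆ F̄`, curve `E_F`, prime `l` and bad-place predicates, with the same `V^bad_mod`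
and the same `V̲` (only the free `π₁`-interface field `geom` is re-glued along the twisted profinite
model of `exists_thetaGeometry_piXK_not_invariant`), for which the typed Remark 3.1.2 (i) FAILS:
some bicontinuous automorphism of `Π_{C_K}` moves `Π_{X_K}`.
[cite: Mochizuki2012, IUTchI Rmk 3.1.2 (i) p.64] -/
theorem exists_not_piXKCharacteristic (D : InitialThetaData F K Fbar E l P) :
    ∃ D' : InitialThetaData F K Fbar E l P,
      D'.VbadMod = D.VbadMod ∧ D'.V = D.V ∧ ¬ D'.PiXKCharacteristic := by
  haveI := D.isAlgClosure
  haveI := D.isScalarTower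
  haveI : Algebra.IsAlgebraic F Fbar := IsAlgClosure.isAlgebraic
  haveI : IsGalois F Fbar := {}
  haveI : NeZero l := ⟨by have := D.five_le_l; omega⟩
  have h6 : l.Coprime 6 := by
    have h2 : ¬ 2 ∣ l := fun h => by
      have := (Nat.prime_dvd_prime_iff_eq Nat.prime_two D.l_prime).mp h; have := D.five_le_l; omega
    have h3 : ¬ 3 ∣ l := fun h => by
      have := (Nat.prime_dvd_prime_iff_eq Nat.prime_three D.l_prime).mp h; have := D.five_le_l; omega
    have h2' : l.Coprime 2 := (Nat.Prime.coprime_iff_not_dvd Nat.prime_two).mpr h2 |>.symm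
    have h3' : l.Coprime 3 := (Nat.Prime.coprime_iff_not_dvd Nat.prime_three).mpr h3 |>.symm
    simpa using Nat.Coprime.mul_right h2' h3'
  obtain ⟨G, φ, hφ, hφs, hne⟩ := exists_thetaGeometry_piXK_not_invariant
    (galoisSubgroupOf F K Fbar) l (ThetaGeometryModel.isClosed_galoisSubgroupOf F K Fbar)
    D.five_le_l h6
  refine ⟨{ D with geom := G }, rfl, rfl, ?_⟩
  intro h
  exact hne (h φ hφ hφs)

/-- **F-0266, closure form.**  The universal closure of the typed [IUTchI] Remark 3.1.2 (i) over all
initial Θ-data with given carriers, curve, prime and bad-place predicates FAILS as soon as that type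
is inhabited: `PiXKCharacteristic` is a schema in the free `π₁`-interface slot `geom`, to be consumed
at a NAMED étale inhabitant only (where it is the content of [AbsTopI] Lemma 4.5).
[cite: Mochizuki2012, IUTchI Rmk 3.1.2 (i) p.64] -/
theorem not_forall_piXKCharacteristic (D : InitialThetaData F K Fbar E l P) :
    ¬ ∀ D' : InitialThetaData F K Fbar E l P, D'.PiXKCharacteristic := by
  obtain ⟨D', -, -, hD'⟩ := exists_not_piXKCharacteristic D
  exact fun h => hD' (h D')

/-- The same, as an equivalence: the universal closure of the row over a parameter tuple holds iff
the type of initial Θ-data over that tuple is EMPTY. [cite: Mochizuki2012, IUTchI Rmk 3.1.2 (i) p.64] -/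
theorem forall_piXKCharacteristic_iff_isEmpty :
    (∀ D : InitialThetaData F K Fbar E l P, D.PiXKCharacteristic) ↔
      IsEmpty (InitialThetaData F K Fbar E l P) :=
  ⟨fun h => ⟨fun D => not_forall_piXKCharacteristic D h⟩, fun h D => (h.false D).elim⟩

end Row

end Literature.IUT.HodgeTheaters.InitialThetaData

end
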